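import Summits.Ventures.HSemireg.JetWedgeCocycle
import Summits.Ventures.HSemireg.NineDiagramDelta
import Summits.Ventures.HSemireg.UntwistComplexLeibnizStep
import HarnessLib

/-!
# Venture HSemireg — route R1.0, complex carriers: CENTRALITY `ν_j · At_{j+1} = At_j · ν_{j+1}` in `D(X)`
# (gs-g4 gen 22, brick C6 of `general-structure/COMPLEX-LEIBNIZ-PLAN-gs-g4.md`)

HONEST FRAMING. Homological algebra on the tree's REAL carriers in the derived category of `𝒪_X`-modules (`X` an
`S`-scheme): for ANY cochain complex `L`, the twisted Atiyah steps `At_j(L) = complexAtiyahStep X j L`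
(connecting morphisms of the termwise `Ωʲ`-twisted Atiyah sequences) COMMUTE with the classes
`ν_j(L) = nuClass c j L` (connecting morphisms of the `dlog`-wedge cocycle extensions, "`1 ⊗ [dlog c]`"). This is the
complex-carrier twin of th-4's Čech-level `AtiyahStepCommute.atiyahClassStep_comp_wedgeClass` (same sign), obtained
here from the `3 × 3` lemma `NineDiagram.comp_triangleOfSESδ_anticomm` applied to the diagram

  `0 → L⊗Ωʲ⁺² → ext(-w_{j+1}) → L⊗Ωʲ⁺¹ → 0`   (column 1, `δ = -ν_{j+1}`)
  `0 → Pʲ⁺¹(L)  → ext(w^P)     → Pʲ(L)    → 0`   (column 2, the jet-level wedge cocycle of `JetWedgeCocycle`)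
  `0 → L⊗Ωʲ⁺¹ → ext(w_j)      → L⊗Ωʲ    → 0`   (column 3, `δ = ν_j`)

whose rows `1` and `3` are the Atiyah sequences `S_{j+1}(L)`, `S_j(L)` (`δ = At_{j+1}`, `At_j`). Nothing about any
variety; nothing here says HC, HC_CM or HC_AV is proved.

## Statements (everything proved)

* `nuClass c j L := triangleOfSESδ (shortExactC (dlogWedgeCocycleC c j L))` (so `nuStep c j K = nuClass c j (K ⊗ M)`,
  `nuStep_eq_nuClass`), and `triangleOfSESδ_shortExactC_neg : δ(ext(-w)) = -δ(ext w)`.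
* `nuNineDiagram c j L` — the `3 × 3` diagram above as a `ShortComplex (ShortComplex (CochainComplex _ ℤ))`.
* **`complexAtiyahStep_comp_nuClass`**: `At_j(L) · ν_{j+1}(L) = ν_j(L) · At_{j+1}(L)` in
  `ShiftedHom (Q(L ⊗ Ωʲ)) (Q(L ⊗ Ωʲ⁺²)) 2` (Mathlib `ShiftedHom.comp`), for every cochain complex `L` and every `j`.

## References

* M. F. Atiyah, Trans. AMS 85 (1957), Prop. 10–12. [Atiyah1957]
* R.-O. Buchweitz, H. Flenner, Compositio Math. 137 (2003), §3, Prop. 3.12 (graded centrality). [BuchweitzFlenner2003]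
* H. Cartan, S. Eilenberg, *Homological Algebra* (1956), III.4 (the `3 × 3` connecting morphisms). [folklore]
-/

noncomputable section

set_option backward.isDefEq.respectTransparency false

open CategoryTheory CategoryTheory.Limits AlgebraicGeometry Opposite TopologicalSpace

namespace Summit.Ventures.HSemireg

namespace CocycleTwist

open Literature.AlgebraicGeometry.Modules Literature.AlgebraicGeometry.Motives
  Literature.AlgebraicGeometry.HodgeTheory

universe w' u

variable {S : Type u} [CommRing S] {X : Over (Spec (CommRingCat.of S))} (c : UnitCocycle X.left) (j : ℕ)
  (L : CochainComplex X.left.Modules ℤ)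

/-! ### The comparison to the opposite cocycle and the `3 × 3` diagram (no derived category needed) -/

section Diagram

variable {c} in
/-- The comparison `(−𝟙, map(𝟙, −𝟙), 𝟙)` from the extension along `w` to the extension along `-w`. [folklore] -/
def shortComplexCNegHom {A B : CochainComplex X.left.Modules ℤ} (w : LocalOneCocycleC c A B) :
    CocycleExtension.shortComplexC w ⟶ CocycleExtension.shortComplexC w.neg where
  τ₁ := -𝟙 B
  τ₂ := CocycleExtension.mapC w w.neg (𝟙 A) (-𝟙 B) w.compat_neg
  τ₃ := 𝟙 A
  comm₁₂ := (CocycleExtension.ιC_mapC w w.neg (𝟙 A) (-𝟙 B) w.compat_neg).symm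
  comm₂₃ := CocycleExtension.mapC_πC w w.neg (𝟙 A) (-𝟙 B) w.compat_neg

/-! ### The `3 × 3` diagram -/

/-- The middle row is a complex in each column: `map(ι, ι) ≫ map(π, π) = 0`. [folklore] -/
theorem mapC_ι_comp_mapC_π :
    CocycleExtension.mapC (dlogWedgeCocycleC c (j + 1) L).neg (jetWedgeCocycleC j c L)
        (twistJetComplexShortComplex X j L).f (twistJetComplexShortComplex X (j + 1) L).f (compat_ι_jetWedge c j L) ≫
      CocycleExtension.mapC (jetWedgeCocycleC j c L) (dlogWedgeCocycleC c j L)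
        (twistJetComplexShortComplex X j L).g (twistJetComplexShortComplex X (j + 1) L).g (compat_jetWedge_π c j L) =
      0 := by
  refine HomologicalComplex.hom_ext _ _ fun i => ?_
  rw [HomologicalComplex.comp_f, HomologicalComplex.zero_f, CocycleExtension.mapC_f, CocycleExtension.mapC_f,
    CocycleExtension.map_comp _ _ _ _ _ _ _ _ _
      (CocycleExtension.compat_comp _ _ _ (compat_ι_jetWedge c j L i) (compat_jetWedge_π c j L i))]
  refine CocycleExtension.map_eq_zero _ _ ?_ ?_ _
  · rw [← HomologicalComplex.comp_f, (twistJetComplexShortComplex X j L).zero, HomologicalComplex.zero_f]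
  · rw [← HomologicalComplex.comp_f, (twistJetComplexShortComplex X (j + 1) L).zero, HomologicalComplex.zero_f]

/-- **The `3 × 3` diagram of complexes** whose rows are the Atiyah sequences `S_{j+1}(L)`, `S_j(L)` and whose
columns are the cocycle extensions along `-w_{j+1}`, `w^P`, `w_j`. [folklore] -/
def nuNineDiagram : ShortComplex (ShortComplex (CochainComplex X.left.Modules ℤ)) :=
  ShortComplex.mk
    (X₁ := CocycleExtension.shortComplexC (dlogWedgeCocycleC c (j + 1) L).neg)
    (X₂ := CocycleExtension.shortComplexC (jetWedgeCocycleC j c L))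
    (X₃ := CocycleExtension.shortComplexC (dlogWedgeCocycleC c j L))
    { τ₁ := (twistJetComplexShortComplex X (j + 1) L).f
      τ₂ := CocycleExtension.mapC (dlogWedgeCocycleC c (j + 1) L).neg (jetWedgeCocycleC j c L)
        (twistJetComplexShortComplex X j L).f (twistJetComplexShortComplex X (j + 1) L).f (compat_ι_jetWedge c j L)
      τ₃ := (twistJetComplexShortComplex X j L).f
      comm₁₂ := (CocycleExtension.ιC_mapC _ _ _ _ _).symm
      comm₂₃ := CocycleExtension.mapC_πC _ _ _ _ _ }
    { τ₁ := (twistJetComplexShortComplex X (j + 1) L).g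
      τ₂ := CocycleExtension.mapC (jetWedgeCocycleC j c L) (dlogWedgeCocycleC c j L)
        (twistJetComplexShortComplex X j L).g (twistJetComplexShortComplex X (j + 1) L).g (compat_jetWedge_π c j L)
      τ₃ := (twistJetComplexShortComplex X j L).g
      comm₁₂ := (CocycleExtension.ιC_mapC _ _ _ _ _).symm
      comm₂₃ := CocycleExtension.mapC_πC _ _ _ _ _ }
    (by
      refine ShortComplex.hom_ext _ _ ?_ ?_ ?_
      · exact (twistJetComplexShortComplex X (j + 1) L).zero
      · exact mapC_ι_comp_mapC_π c j L
      · exact (twistJetComplexShortComplex X j L).zero)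

/-- Row `1` of the `3 × 3` diagram is the Atiyah sequence `S_{j+1}(L)` (short exact). [folklore] -/
theorem nuNineDiagram_row₁_shortExact : (NineDiagram.row₁ (nuNineDiagram c j L)).ShortExact :=
  twistJetComplexShortComplex_shortExact (X := X) (j + 1) L

/-- Row `3` of the `3 × 3` diagram is the Atiyah sequence `S_j(L)` (short exact). [folklore] -/
theorem nuNineDiagram_row₃_shortExact : (NineDiagram.row₃ (nuNineDiagram c j L)).ShortExact :=
  twistJetComplexShortComplex_shortExact (X := X) j L

end Diagram

/-! ### The class `ν_j(L)`, negation, and centrality (in the derived category) -/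

section Derived

variable [HasDerivedCategory.{w'} X.left.Modules]

/-- **`ν_j(L)`**: the connecting morphism of the `dlog`-wedge cocycle extension
`0 → L ⊗ Ωʲ⁺¹ → extC (dlogWedgeCocycleC c j L) → L ⊗ Ωʲ → 0` — the class "`1_L ⊗ [dlog c] ∧ –`".
[cite: Atiyah1957, Prop. 12] -/
def nuClass :
    DerivedCategory.Q.obj (twistHodgeComplex X j L) ⟶ (DerivedCategory.Q.obj (twistHodgeComplex X (j + 1) L))⟦(1 : ℤ)⟧ :=
  DerivedCategory.triangleOfSESδ (CocycleExtension.shortExactC (dlogWedgeCocycleC c j L))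

/-- g21's `nuStep c j K` is `ν_j(K ⊗ M)`. [folklore] -/
theorem nuStep_eq_nuClass (K : CochainComplex X.left.Modules ℤ) : nuStep c j K = nuClass c j (cocycleTwistComplex c K) :=
  rfl

variable {c} in
/-- **`δ(ext(-w)) = -δ(ext w)`** (naturality of the connecting morphism along `(−𝟙, map, 𝟙)`). [folklore] -/
theorem triangleOfSESδ_shortExactC_neg {A B : CochainComplex X.left.Modules ℤ} (w : LocalOneCocycleC c A B) :
    DerivedCategory.triangleOfSESδ (CocycleExtension.shortExactC w.neg) =
      -DerivedCategory.triangleOfSESδ (CocycleExtension.shortExactC w) := by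
  have h := DerivedCategory.triangleOfSESδ_naturality (CocycleExtension.shortExactC w)
    (CocycleExtension.shortExactC w.neg) (shortComplexCNegHom w)
  dsimp only [shortComplexCNegHom] at h
  rw [Functor.map_neg, Functor.map_neg, CategoryTheory.Functor.map_id, CategoryTheory.Functor.map_id,
    CategoryTheory.Functor.map_id, Preadditive.comp_neg, Category.comp_id, Category.id_comp] at h
  exact h.symm


/-- **The Atiyah steps commute with the classes `ν`, unshifted form**:
`At_j(L) ≫ ν_{j+1}(L)⟦1⟧' = ν_j(L) ≫ At_{j+1}(L)⟦1⟧' : Q(L ⊗ Ωʲ) ⟶ Q(L ⊗ Ωʲ⁺²)⟦1⟧⟦1⟧`.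
[cite: BuchweitzFlenner2003, Prop. 3.12] -/
theorem complexAtiyahStep_comp_nuClass_shift :
    complexAtiyahStep X j L ≫ (nuClass c (j + 1) L)⟦(1 : ℤ)⟧' =
      nuClass c j L ≫ (complexAtiyahStep X (j + 1) L)⟦(1 : ℤ)⟧' := by
  have h := NineDiagram.triangleOfSESδ_row₃_col₁_eq_neg (nuNineDiagram_row₁_shortExact c j L)
    (nuNineDiagram_row₃_shortExact c j L) (CocycleExtension.shortExactC (dlogWedgeCocycleC c (j + 1) L).neg)
    (CocycleExtension.shortExactC (jetWedgeCocycleC j c L)) (CocycleExtension.shortExactC (dlogWedgeCocycleC c j L))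
  rw [triangleOfSESδ_shortExactC_neg, Functor.map_neg, Preadditive.comp_neg, neg_inj] at h
  exact h

/-- **CENTRALITY: the Atiyah steps commute with the classes `ν_j = 1 ⊗ [dlog c]`** — for EVERY cochain complex `L`
of `𝒪_X`-modules and every `j`, in `ShiftedHom (Q(L ⊗ Ωʲ)) (Q(L ⊗ Ωʲ⁺²)) 2`:
`At_j(L) · ν_{j+1}(L) = ν_j(L) · At_{j+1}(L)` (Mathlib `ShiftedHom.comp` order: first `At_j`, then `ν_{j+1}`).
[cite: BuchweitzFlenner2003, Prop. 3.12] -/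
theorem complexAtiyahStep_comp_nuClass (h : (1 : ℤ) + 1 = 2) :
    (complexAtiyahStep X j L).comp (nuClass c (j + 1) L : ShiftedHom _ _ (1 : ℤ)) h =
      ShiftedHom.comp (M := ℤ) (a := 1) (b := 1) (nuClass c j L) (complexAtiyahStep X (j + 1) L) h := by
  simp only [ShiftedHom.comp]
  rw [← Category.assoc, complexAtiyahStep_comp_nuClass_shift, Category.assoc]

end Derived

end CocycleTwist

end Summit.Ventures.HSemireg

end
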